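import Summits.QuantumFields.YangMills.Theorems.AlphaInputsT3ACv3SmoothLiftCandidateAllL
import HarnessLib

/-!
# `AlphaInputsT3ACv3SmoothLiftCandidateDefect` — the START candidate IN THE CURRENCY OF ★w4's R6-FLAT model Newton lift: for the coarse datum `V(c) := exp(A c) ∈ SU(n)` and the
# candidate `U₀ := cand k A` of `…SmoothLiftCandidate(AllL)`, the MULTIPLICATIVE DEFECT `‖Ū₀^{(k)}(c)·V(c)* − 1‖ ≤ (K₁ + 3)·M²` (k-free, every odd `L > 1`) and `L^k·sup‖U₀ − 1‖ ≤ 2C_S·M` —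
# exactly the `(U₀, η, η₀)` input of R6-FLAT («`‖U₀,b − 1‖ ≤ η`, `‖Ū₀^{(k)}(c)·V(c)* − 1‖ ≤ η₀` on every coarse bond, one row `poly·(L^k η + η₀) ≤ 1`») — cell `ym3-torus`, width seat
# `ym-ust-19936-w2` (g2); ★★OWNER g25 01:58:53Z (c) «the one by-name junction check 19936's KIN∕(FL) chain still lacks», first half (the second half composes with R6-FLAT (B) when it lands)

WHY.  ★w4-19936's CLAIM R6-FLAT (01:41:16Z) produces the EXACT lift `U = e^{a}U₀` from ANY finest `U₀` near `1` whose k-fold averages are near `V`; the START for coarse data `V = exp A`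
is this seat's candidate.  Its averages were stated additively (`Ū₀ = 1 + A + O(M²)`); R6-FLAT reads the defect multiplicatively through `V(c)* = exp(−A c)`:
`Ū₀V* − 1 = (Ū₀ − 1 − A)·V* + ((1 + A)e^{−A} − 1)`, the first term keeps its norm (`V*` unitary), the second is `≤ 3‖A‖²` (`(1+A)e^{−A} − 1 = R₂(−A) + A·R₂(−A) − A²`, `‖R₂‖ ≤ ‖A‖²`).
WHAT.  `dataSU k A hA : GaugeField P k SU(n) := c ↦ expSU (A c)` (one def), `coe_dataSU`, `star_coe_dataSU` (`V(c)* = exp(−A c)`); `norm_one_add_mul_exp_neg_sub_one_le` (`≤ 3‖X‖²` for `‖X‖ ≤ 1`);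
★★ `norm_iter_cand_mul_star_data_sub_one_le_allL` (`η₀ ≤ (K₁ + 3)·M²`, `K₁` = the AllL constant of `norm_iter_cand_sub_one_sub_le_allL`); ★★★ `exists_start_for_newtonFlat_allL` — ∃ `U₀` with
`‖U₀,b − 1‖ ≤ 2C_S M/L^k` (so `L^k·η = 2C_S·M`), every finest plaquette within `(4·18^d M + 16(C_S M)²)/(L^k)²`, and `‖Ū₀^{(k)}(c)·V(c)* − 1‖ ≤ (K₁ + 3)·M²` on EVERY coarse bond.
HONEST FRAMING.  A composition of landed kernel lemmas; count-neutral helper toward R3 2′ (items 19936∕19935, `--supports stmt-QuantumFields-19936`); `hLift`∕(FL), the stub, the crux and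
the gap are NOT claimed; registry untouched; YM₃ on T³ is rung R3, not the Clay problem.

References: T. Bałaban, Commun. Math. Phys. 98 (1985) 17–51 [Balaban1985Averaging] (Prop. 4 (134)–(135) p.38); Commun. Math. Phys. 102 (1985) 277–309 [Balaban1985Variational]
(Thm 1 (8) p.279, (11)–(13) pp.279–280).
-/

set_option autoImplicit false

noncomputable section

open scoped Matrix.Norms.L2Operator
open NormedSpace

namespace Summit.QuantumFields.YangMills.Theorems.SmoothLiftCandidate

open Literature.MathematicalPhysics.QuantumFieldTheory.Balaban1983to89
open T4Continuum AveragingRT BlockAveraging ExpMeanLog BlockAveragingEMLLinearised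
open Literature.MathematicalPhysics.QuantumFieldTheory.Balaban1983to89.T4AdjointCovarianceUnitary (lieSU expSU coe_expSU mem_lieSU_iff)
open Literature.MathematicalPhysics.QuantumFieldTheory.OneLinkLaplace (norm_exp_sub_one_sub_le_sq)
open Summit.QuantumFields.YangMills.Theorems.LinearLiftMatrix (CS CS_nonneg)

variable {P : Params} {n : Type*} [Fintype n] [DecidableEq n] [Nonempty n]

/-- **THE COARSE DATUM AS AN `SU(n)` FIELD**: `V(c) := exp(A c)` for `𝔰𝔲(n)`-valued `A` (the stencil logarithm re-exponentiated; in the model frame the datum IS `exp A`).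
[cite: Balaban1985Variational, (11) p.279] -/
def dataSU (k : ℕ) (A : PBond P k → Matrix n n ℂ) (hA : ∀ c, A c ∈ lieSU n) : GaugeField P k (Matrix.specialUnitaryGroup n ℂ) :=
  fun c => expSU ⟨A c, hA c⟩

variable (k : ℕ) (hk : k ≤ P.m + P.K)

omit [Nonempty n] in
/-- `V(c) = exp(A c)` on matrices. [cite: Balaban1985Variational, (11) p.279] -/
theorem coe_dataSU (A : PBond P k → Matrix n n ℂ) (hA : ∀ c, A c ∈ lieSU n) (c : PBond P k) :
    ((dataSU k A hA c : Matrix.specialUnitaryGroup n ℂ) : Matrix n n ℂ) = exp (A c) := rfl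

omit [Nonempty n] in
/-- `V(c)* = exp(−A c)` (`A c` is skew-Hermitian). [cite: Balaban1985Variational, (11) p.279] -/
theorem star_coe_dataSU (A : PBond P k → Matrix n n ℂ) (hA : ∀ c, A c ∈ lieSU n) (c : PBond P k) :
    star ((dataSU k A hA c : Matrix.specialUnitaryGroup n ℂ) : Matrix n n ℂ) = exp (-A c) := by
  rw [coe_dataSU, star_exp, (mem_lieSU_iff.mp (hA c)).1]

omit [Nonempty n] [DecidableEq n] [Fintype n] in
/-- `‖(1 + X)·e^{−X} − 1‖ ≤ 3‖X‖²` for `‖X‖ ≤ 1` (`(1+X)e^{−X} − 1 = R + X·R − X²`, `R = e^{−X} − 1 + X`, `‖R‖ ≤ ‖X‖²`). [folklore] -/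
theorem norm_one_add_mul_exp_neg_sub_one_le {𝔸 : Type*} [NormedRing 𝔸] [NormedAlgebra ℝ 𝔸] [NormOneClass 𝔸] [CompleteSpace 𝔸] (X : 𝔸) (hX : ‖X‖ ≤ 1) :
    ‖(1 + X) * exp (-X) - 1‖ ≤ 3 * ‖X‖ ^ 2 := by
  set R : 𝔸 := exp (-X) - 1 - (-X) with hR
  have hRn : ‖R‖ ≤ ‖X‖ ^ 2 := by
    have h := norm_exp_sub_one_sub_le_sq (X := -X) (by rwa [norm_neg])
    rwa [norm_neg] at h
  have e : (1 + X) * exp (-X) - 1 = R + X * R - X * X := by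
    have : exp (-X) = R + 1 - X := by rw [hR]; abel
    rw [this]; noncomm_ring
  rw [e]
  have h0 : 0 ≤ ‖X‖ := norm_nonneg _
  calc ‖R + X * R - X * X‖ ≤ ‖R‖ + ‖X * R‖ + ‖X * X‖ := by
        refine (norm_sub_le _ _).trans (add_le_add (norm_add_le _ _) le_rfl)
    _ ≤ ‖X‖ ^ 2 + ‖X‖ * ‖X‖ ^ 2 + ‖X‖ * ‖X‖ :=
        add_le_add (add_le_add hRn ((norm_mul_le _ _).trans (mul_le_mul_of_nonneg_left hRn h0))) (norm_mul_le _ _)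
    _ ≤ 3 * ‖X‖ ^ 2 := by nlinarith

include hk in
/-- **★★ THE CANDIDATE'S MULTIPLICATIVE DEFECT AGAINST THE DATUM, k-FREE AT EVERY `L`**: `‖Ū₀^{(k)}(c)·V(c)* − 1‖ ≤ (K₁ + 3)·M²` with `K₁` the AllL constant of
`norm_iter_cand_sub_one_sub_le_allL` — R6-FLAT's `η₀`. [cite: Balaban1985Averaging, Prop. 4 (134)–(135) p.38; Balaban1985Variational, (11)–(13) pp.279–280] -/
theorem norm_iter_cand_mul_star_data_sub_one_le_allL (A : PBond P k → Matrix n n ℂ) (hA : ∀ c, A c ∈ lieSU n) {M : ℝ} (hM : ∀ c, ‖A c‖ ≤ M) (hM1 : CS P * M ≤ 1) (hM1' : M ≤ 1)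
    (hm : (((P.d : ℝ) + 1) * ((18 : ℝ) ^ P.d * (2 + ((P.d : ℝ) + 1) * (18 : ℝ) ^ P.d)) * (324 * (((P.d + 2) * P.L : ℕ) : ℝ) ^ 2) / ((P.L : ℝ) * ((P.L : ℝ) - 1))) * (2 * (((P.d : ℝ) + 1) * (CS P * M))) ≤ 1)
    (h32 : 32 * (((P.d + 2) * P.L : ℕ) : ℝ) * (2 * (((P.d : ℝ) + 1) * (CS P * M))) ≤ 1)
    (hN : 4 * (((P.d + 2) * P.L : ℕ) : ℝ) * (2 * (((P.d : ℝ) + 1) * (CS P * M))) < deltaSU n) (c : PBond P k) :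
    ‖((Averaging.iter (fun i => blockAvg (P := P) (j := i) (expMeanLogSU (n := n))) k (cand k A hA) c : Matrix.specialUnitaryGroup n ℂ) : Matrix n n ℂ) *
          star ((dataSU k A hA c : Matrix.specialUnitaryGroup n ℂ) : Matrix n n ℂ) - 1‖ ≤
      (((((P.d : ℝ) + 1) * ((18 : ℝ) ^ P.d * (2 + ((P.d : ℝ) + 1) * (18 : ℝ) ^ P.d)) * (324 * (((P.d + 2) * P.L : ℕ) : ℝ) ^ 2) / ((P.L : ℝ) * ((P.L : ℝ) - 1))) *
            (2 * (((P.d : ℝ) + 1) * CS P)) ^ 2 + ((P.d : ℝ) + 1) * CS P ^ 2) + 3) * M ^ 2 := by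
  obtain ⟨-, h2⟩ := norm_iter_cand_sub_one_sub_le_allL k hk A hA hM hM1 hm h32 hN c
  set Ubar : Matrix n n ℂ := ((Averaging.iter (fun i => blockAvg (P := P) (j := i) (expMeanLogSU (n := n))) k (cand k A hA) c : Matrix.specialUnitaryGroup n ℂ) : Matrix n n ℂ)
    with hUbar
  set W : Matrix.specialUnitaryGroup n ℂ := (dataSU k A hA c)⁻¹ with hW
  have hWcoe : (W : Matrix n n ℂ) = star ((dataSU k A hA c : Matrix.specialUnitaryGroup n ℂ) : Matrix n n ℂ) := rfl
  have hAc : ‖A c‖ ≤ 1 := (hM c).trans hM1'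
  -- split: `Ū V* − 1 = (Ū − 1 − A)·V* + ((1 + A)·V* − 1)`, `V* = exp(−A)`
  have e : Ubar * star ((dataSU k A hA c : Matrix.specialUnitaryGroup n ℂ) : Matrix n n ℂ) - 1 =
      (Ubar - 1 - A c) * (W : Matrix n n ℂ) + ((1 + A c) * exp (-A c) - 1) := by
    rw [hWcoe, star_coe_dataSU]; noncomm_ring
  rw [e]
  have t1 : ‖(Ubar - 1 - A c) * (W : Matrix n n ℂ)‖ = ‖Ubar - 1 - A c‖ := CStarRing.norm_mul_mem_unitary _ W.2.1
  have t2 := norm_one_add_mul_exp_neg_sub_one_le (A c) hAc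
  have hM0 : 0 ≤ M := (norm_nonneg _).trans (hM c)
  have hsq : ‖A c‖ ^ 2 ≤ M ^ 2 := pow_le_pow_left₀ (norm_nonneg _) (hM c) 2
  calc ‖(Ubar - 1 - A c) * (W : Matrix n n ℂ) + ((1 + A c) * exp (-A c) - 1)‖
      ≤ ‖(Ubar - 1 - A c) * (W : Matrix n n ℂ)‖ + ‖(1 + A c) * exp (-A c) - 1‖ := norm_add_le _ _
    _ ≤ ((((P.d : ℝ) + 1) * ((18 : ℝ) ^ P.d * (2 + ((P.d : ℝ) + 1) * (18 : ℝ) ^ P.d)) * (324 * (((P.d + 2) * P.L : ℕ) : ℝ) ^ 2) / ((P.L : ℝ) * ((P.L : ℝ) - 1))) *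
            (2 * (((P.d : ℝ) + 1) * CS P)) ^ 2 + ((P.d : ℝ) + 1) * CS P ^ 2) * M ^ 2 + 3 * M ^ 2 := by
        rw [t1]; exact add_le_add h2 (t2.trans (by nlinarith))
    _ = _ := by ring

include hk in
/-- **★★★ THE START FOR THE MODEL NEWTON LIFT, AT EVERY ODD `L > 1`**: for `𝔰𝔲(n)`-valued coarse data `A` with `‖A‖ ≤ M` small, the candidate `U₀ := cand k A` and the datum `V := exp A`
satisfy R6-FLAT's three inputs — `‖U₀,b − 1‖ ≤ 2C_S·M/L^k` (so `L^k·η = 2C_S·M`), every finest plaquette of `U₀` within `(4·18^d·M + 16(C_S M)²)/(L^k)²`, and the multiplicative defect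
`‖Ū₀^{(k)}(c)·V(c)* − 1‖ ≤ (K₁ + 3)·M²` on EVERY coarse bond. [cite: Balaban1985Variational, Thm 1 (8) p.279, (11)–(13) pp.279–280; Balaban1985Averaging, Prop. 4 (134)–(135) p.38] -/
theorem exists_start_for_newtonFlat_allL (A : PBond P k → Matrix n n ℂ) (hA : ∀ c, A c ∈ lieSU n) {M : ℝ} (hM : ∀ c, ‖A c‖ ≤ M) (hM4 : 4 * (CS P * M) ≤ 1) (hM1' : M ≤ 1)
    (hm : (((P.d : ℝ) + 1) * ((18 : ℝ) ^ P.d * (2 + ((P.d : ℝ) + 1) * (18 : ℝ) ^ P.d)) * (324 * (((P.d + 2) * P.L : ℕ) : ℝ) ^ 2) / ((P.L : ℝ) * ((P.L : ℝ) - 1))) * (2 * (((P.d : ℝ) + 1) * (CS P * M))) ≤ 1)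
    (h32 : 32 * (((P.d + 2) * P.L : ℕ) : ℝ) * (2 * (((P.d : ℝ) + 1) * (CS P * M))) ≤ 1)
    (hN : 4 * (((P.d + 2) * P.L : ℕ) : ℝ) * (2 * (((P.d : ℝ) + 1) * (CS P * M))) < deltaSU n) :
    ∃ U₀ : GaugeField P 0 (Matrix.specialUnitaryGroup n ℂ),
      (∀ b, ‖((U₀ b : Matrix.specialUnitaryGroup n ℂ) : Matrix n n ℂ) - 1‖ ≤ 2 * (CS P * M / (P.L : ℝ) ^ k)) ∧
      (∀ q : Plaq P 0, GaugeGroup.dist1 (GaugeField.plaqHol U₀ q) ≤ 4 * (18 : ℝ) ^ P.d * M / ((P.L : ℝ) ^ k) ^ 2 + 16 * (CS P * M / (P.L : ℝ) ^ k) ^ 2) ∧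
      ∀ c : PBond P k,
        ‖((Averaging.iter (fun i => blockAvg (P := P) (j := i) (expMeanLogSU (n := n))) k U₀ c : Matrix.specialUnitaryGroup n ℂ) : Matrix n n ℂ) *
              star ((dataSU k A hA c : Matrix.specialUnitaryGroup n ℂ) : Matrix n n ℂ) - 1‖ ≤
          (((((P.d : ℝ) + 1) * ((18 : ℝ) ^ P.d * (2 + ((P.d : ℝ) + 1) * (18 : ℝ) ^ P.d)) * (324 * (((P.d + 2) * P.L : ℕ) : ℝ) ^ 2) / ((P.L : ℝ) * ((P.L : ℝ) - 1))) *
                (2 * (((P.d : ℝ) + 1) * CS P)) ^ 2 + ((P.d : ℝ) + 1) * CS P ^ 2) + 3) * M ^ 2 := by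
  have hM1 : CS P * M ≤ 1 := by
    have : 0 ≤ CS P * M := by
      have hM0 : 0 ≤ M := (norm_nonneg _).trans (hM ⟨fun _ => 0, ⟨0, P.hd⟩⟩)
      exact mul_nonneg (CS_nonneg P) hM0
    linarith
  exact ⟨cand k A hA, fun b => (norm_coe_cand_sub_one_le k hk A hA hM hM1 b).1, fun q => dist1_plaqHol_cand_le k hk A hA hM hM4 q,
    fun c => norm_iter_cand_mul_star_data_sub_one_le_allL k hk A hA hM hM1 hM1' hm h32 hN c⟩

end Summit.QuantumFields.YangMills.Theorems.SmoothLiftCandidate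

end
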